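import Literature.NumberTheory.CubicFields.DavenportHeilbronnMaximality
import Literature.NumberTheory.CubicFields.DeloneFaddeevAutomorphisms
import Mathlib.LinearAlgebra.Matrix.ToLinearEquiv
import Mathlib.Data.Nat.Factorization.Basic
import HarnessLib

/-!
# Davenport–Heilbronn maximality, the converse: `f ∈ U_p` for all `p` ⇒ `R(f)` is maximal

Topic `Literature/NumberTheory/CubicFields`, completing `DavenportHeilbronnMaximality.lean`
(`BinaryCubic.MemU p f` = "`f ∈ U_p`", `RingOfForm.IsMaximal f`, and the direction
"maximal ⇒ `f ∈ U_p`").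

Bhargava–Taniguchi–Thorne 2023, Prop. 2.2 ([Davenport–Heilbronn]): "a cubic ring `R` is maximal
if and only if any corresponding cubic form `f` belongs to `U_p` for all `p`." This file proves the
remaining direction and assembles the equivalence:

* `RingOfForm.exists_intCast_mul_eq_of_injective` — an injective `φ : R(f) → R(g)` has image of
  finite index: `D · R(g) ⊆ φ(R(f))` with `D ≠ 0` the determinant of `φ` on `R/ℤ`;
* `RingOfForm.exists_prime_overring` — if moreover `φ` is not surjective, there are a prime `p` and
  an intermediate ring `φ(R(f)) ⊊ T ⊆ R(g)` with `pT ⊆ φ(R(f))` (`T = φ(R f) + p^{k-1} S_p`);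
* `RingOfForm.key` — for such `T`, after a `GL₂(ℤ)`-change of basis of `R(f)` making `(u + ω)/p ∈ T`,
  the ring axioms of `T` force `p² ∣ a, p ∣ b` (when `T ∋ ω/p` only) or `p ∣ f` (when
  `T ∋ ω/p, θ/p`) — the classification of index-`p` overrings behind `U_p`;
* `RingOfForm.isMaximal_of_memU` — **`f ∈ U_p` for all primes `p` ⇒ `R(f)` maximal**;
* `RingOfForm.isMaximal_iff_memU` — **BTT Prop. 2.2**: `R(f)` is maximal iff `f ∈ U_p` for all
  primes `p`.

## References

* M. Bhargava, T. Taniguchi, F. Thorne, *Improved error estimates for the Davenport–Heilbronn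
  theorems*, Math. Ann. 389 (2024) = arXiv:2107.12819, Prop. 2.2 [BhargavaTaniguchiThorne2023].
* H. Davenport, H. Heilbronn, *On the density of discriminants of cubic fields. II*, Proc. Roy.
  Soc. London A 322 (1971) 405–420 [DavenportHeilbronn1971].
* M. Bhargava, A. Shankar, J. Tsimerman, *On the Davenport–Heilbronn theorems and second order
  terms*, Invent. Math. 193 (2013), §3.2 [BhargavaShankarTsimerman2012].
-/

namespace Literature.NumberTheory.CubicFields

namespace RingOfForm

open BinaryCubic Module

variable {f g : BinaryCubic ℤ}

/-! ### Coordinate helpers -/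

/-- Coordinates of an integer multiple. [folklore] -/
@[simp] theorem intCast_mul_x (n : ℤ) (P : RingOfForm g) : ((n : RingOfForm g) * P).x = n * P.x := by simp
/-- Coordinates of an integer multiple. [folklore] -/
@[simp] theorem intCast_mul_y (n : ℤ) (P : RingOfForm g) : ((n : RingOfForm g) * P).y = n * P.y := by simp
/-- Coordinates of an integer multiple. [folklore] -/
@[simp] theorem intCast_mul_z (n : ℤ) (P : RingOfForm g) : ((n : RingOfForm g) * P).z = n * P.z := by simp

/-- `R(g)` is torsion-free: `n P = n Q`, `n ≠ 0` ⇒ `P = Q`. [folklore] -/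
theorem intCast_mul_cancel {n : ℤ} (hn : n ≠ 0) {P Q : RingOfForm g} (h : (n : RingOfForm g) * P = n * Q) :
    P = Q := by
  have hx := congrArg RingOfForm.x h
  have hy := congrArg RingOfForm.y h
  have hz := congrArg RingOfForm.z h
  simp only [intCast_mul_x, intCast_mul_y, intCast_mul_z] at hx hy hz
  ext
  · exact mul_left_cancel₀ hn hx
  · exact mul_left_cancel₀ hn hy
  · exact mul_left_cancel₀ hn hz

/-- If `n P = Q` then `n` divides the coordinates of `Q`. [folklore] -/
theorem dvd_coord_of_natCast_mul_eq {n : ℕ} {P Q : RingOfForm g} (h : (n : RingOfForm g) * P = Q) :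
    (n : ℤ) ∣ Q.x ∧ (n : ℤ) ∣ Q.y ∧ (n : ℤ) ∣ Q.z := by
  subst h
  exact ⟨⟨P.x, by simp⟩, ⟨P.y, by simp⟩, ⟨P.z, by simp⟩⟩

/-- The element with coordinates `(x, y, z)` is `x + yω + zθ`; products of such explicit elements
are computed by `ext; simp`. The five products used below: [folklore] -/
theorem mk_one_zero_mul_theta (u : ℤ) : (⟨u, 1, 0⟩ : RingOfForm f) * theta f = ⟨-(f.a * f.d), 0, u⟩ := by
  ext <;> simp
/-- `ω² = −ac + bω − aθ` in coordinates. [folklore] -/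
theorem omega_mul_omega_eq : omega f * omega f = (⟨-(f.a * f.c), f.b, -f.a⟩ : RingOfForm f) := by
  ext <;> simp
/-- `θ² = −bd + dω − cθ` in coordinates. [folklore] -/
theorem theta_mul_theta_eq : theta f * theta f = (⟨-(f.b * f.d), f.d, -f.c⟩ : RingOfForm f) := by
  ext <;> simp
/-- `(u + ω)(β + θ)` in coordinates. [folklore] -/
theorem mk_one_zero_mul_mk_zero_one (u β : ℤ) :
    (⟨u, 1, 0⟩ : RingOfForm f) * ⟨β, 0, 1⟩ = ⟨u * β - f.a * f.d, β, u⟩ := by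
  ext <;> simp
/-- `ω (β + θ)` in coordinates. [folklore] -/
theorem omega_mul_mk_zero_one (β : ℤ) : omega f * (⟨β, 0, 1⟩ : RingOfForm f) = ⟨-(f.a * f.d), β, 0⟩ := by
  ext <;> simp

/-- Bezout modulo a prime: if `p ∤ u` there are `e, k` with `e u + k p = 1`. [folklore] -/
theorem exists_mul_add_mul_prime_eq_one {p : ℕ} (hp : p.Prime) {u : ℤ} (hu : ¬ (p : ℤ) ∣ u) :
    ∃ e k : ℤ, e * u + k * p = 1 := by
  have hcop : IsCoprime u (p : ℤ) := by
    rw [Int.isCoprime_iff_gcd_eq_one, Int.gcd_eq_natAbs, Int.natAbs_natCast]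
    rw [Int.natCast_dvd] at hu
    exact Nat.Coprime.symm ((Nat.Prime.coprime_iff_not_dvd hp).mpr hu)
  obtain ⟨e, k, h⟩ := hcop
  exact ⟨e, k, h⟩

/-! ### The key computation: ring axioms of an index-`p` overring -/

section Key

variable (p : ℕ) (φ : RingOfForm f →+* RingOfForm g) (T : Subring (RingOfForm g))

/-- The lattice `L = {r ∈ R(f) : φ(r) ∈ pT}` of an overring `T ⊇ φ(R(f))`, as a predicate. [folklore] -/
def InL (r : RingOfForm f) : Prop :=
  ∃ t ∈ T, (p : RingOfForm g) * t = φ r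

variable {p φ T}

/-- `L` is closed under addition. [folklore] -/
theorem InL.add {r r' : RingOfForm f} (h : InL p φ T r) (h' : InL p φ T r') : InL p φ T (r + r') := by
  obtain ⟨t, ht, he⟩ := h
  obtain ⟨t', ht', he'⟩ := h'
  exact ⟨t + t', T.add_mem ht ht', by rw [mul_add, he, he', map_add]⟩

/-- `L` is closed under integer multiples. [folklore] -/
theorem InL.intCast_mul {r : RingOfForm f} (h : InL p φ T r) (n : ℤ) : InL p φ T (n * r) := by
  obtain ⟨t, ht, he⟩ := h
  refine ⟨n * t, T.mul_mem (intCast_mem T n) ht, ?_⟩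
  rw [map_mul, map_intCast, ← he, mul_left_comm]

/-- `L ⊇ p R(f)` when `T ⊇ φ(R(f))`. [folklore] -/
theorem inL_natCast_mul (hRT : ∀ r, φ r ∈ T) (r : RingOfForm f) : InL p φ T ((p : RingOfForm f) * r) :=
  ⟨φ r, hRT r, by rw [map_mul, map_natCast]⟩

/-- `L`-membership is invariant under translation by `p R(f)`. [folklore] -/
theorem InL.add_natCast_mul (hRT : ∀ r, φ r ∈ T) {r : RingOfForm f} (h : InL p φ T r) (s : RingOfForm f) :
    InL p φ T (r + (p : RingOfForm f) * s) :=
  h.add (inL_natCast_mul hRT s)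

/-- **`1` is primitive in `T`**: if `(x + yω + zθ) ∈ L` with `p ∣ y`, `p ∣ z` then `p ∣ x`
(otherwise `1/p ∈ T ⊆ R(g)`). [folklore] -/
theorem InL.dvd_x {r : RingOfForm f} (h : InL p φ T r) (hy : (p : ℤ) ∣ r.y) (hz : (p : ℤ) ∣ r.z) :
    (p : ℤ) ∣ r.x := by
  obtain ⟨t, -, he⟩ := h
  obtain ⟨y', hy'⟩ := hy
  obtain ⟨z', hz'⟩ := hz
  have hr : r = (r.x : RingOfForm f) + (p : RingOfForm f) * (⟨0, y', z'⟩ : RingOfForm f) := by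
    ext <;> simp [hy', hz']
  have hφr : φ r = (r.x : RingOfForm g) + (p : RingOfForm g) * φ ⟨0, y', z'⟩ := by
    conv_lhs => rw [hr]
    rw [map_add, map_mul, map_intCast, map_natCast]
  have h2 : (p : RingOfForm g) * (t - φ ⟨0, y', z'⟩) = (r.x : RingOfForm g) := by
    rw [mul_sub, he, hφr]
    ring
  have hx := congrArg RingOfForm.x h2
  simp only [mul_x, natCast_x, natCast_y, natCast_z, intCast_x] at hx
  exact ⟨(t - φ ⟨0, y', z'⟩).x, by linear_combination -hx⟩

/-- Products: if `t ∈ T` with `p t = φ r` and `t' ∈ T` with `p t' = φ r'`, and `T ∋ t t'`, `pT ⊆ φ(R f)`,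
then `r r' ∈ p R(f)` (coordinatewise) and `(r r')/p ∈ L`. [folklore] -/
theorem exists_of_mul_mem (hφ : Function.Injective φ) (hpT : ∀ t ∈ T, ∃ r, (p : RingOfForm g) * t = φ r)
    {t t' : RingOfForm g} {r r' : RingOfForm f} (ht : (p : RingOfForm g) * t = φ r)
    (ht' : (p : RingOfForm g) * t' = φ r') (hmem : t * t' ∈ T) :
    ∃ s : RingOfForm f, (p : RingOfForm f) * s = r * r' ∧ InL p φ T s := by
  obtain ⟨s, hs⟩ := hpT _ hmem
  refine ⟨s, hφ ?_, t * t', hmem, hs⟩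
  rw [map_mul, map_natCast, ← hs, map_mul, ← ht, ← ht']
  ring

/-- **The key lemma** (classification of index-`p` overrings; Davenport–Heilbronn, BST §3.2).
Let `φ : R(f) ↪ R(g)` and let `T` be a subring of `R(g)` with `φ(R(f)) ⊆ T` and `pT ⊆ φ(R(f))`,
`p` prime. If `T` contains an element `t₁` with `p t₁ = φ(u + ω)`, then either `p² ∣ a` and
`p ∣ b`, or `f` is a multiple of `p`. [cite: BhargavaTaniguchiThorne2023, Proposition 2.2 (f ∈ U_p ⇒ maximal, the index-p overrings)] -/
theorem key (hp : p.Prime) (hφ : Function.Injective φ) (hRT : ∀ r, φ r ∈ T)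
    (hpT : ∀ t ∈ T, ∃ r, (p : RingOfForm g) * t = φ r) (u : ℤ) (h₁ : InL p φ T ⟨u, 1, 0⟩) :
    ((p : ℤ) ^ 2 ∣ f.a ∧ (p : ℤ) ∣ f.b) ∨ f.IsMultiple p := by
  have hp0 : (p : ℤ) ≠ 0 := by exact_mod_cast hp.ne_zero
  obtain ⟨t₁, ht₁T, ht₁⟩ := h₁
  -- Step (b): `t₁ φ(θ) ∈ T` gives `(−ad, 0, u) ∈ L`
  have hθT : φ (theta f) ∈ T := hRT _
  have hb : InL p φ T ⟨-(f.a * f.d), 0, u⟩ := by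
    refine ⟨t₁ * φ (theta f), T.mul_mem ht₁T hθT, ?_⟩
    rw [← mul_assoc, ht₁, ← map_mul, mk_one_zero_mul_theta]
  -- Step: `p ∣ u` (otherwise `(β, 0, 1) ∈ L` and the product `t₁ t_θ` forces `p ∣ u`)
  have hpu : (p : ℤ) ∣ u := by
    by_contra hu
    obtain ⟨e, k, hek⟩ := exists_mul_add_mul_prime_eq_one hp hu
    -- `(β, 0, 1) ∈ L` with `β = −e a d`
    have hβ : InL p φ T ⟨-(e * (f.a * f.d)), 0, 1⟩ := by
      have h := (hb.intCast_mul e).add_natCast_mul hRT ⟨0, 0, k⟩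
      convert h using 1
      ext <;> simp
      linear_combination -hek
    obtain ⟨tθ, htθT, htθ⟩ := hβ
    obtain ⟨s, hs, -⟩ := exists_of_mul_mem hφ hpT ht₁ htθ (T.mul_mem ht₁T htθT)
    rw [mk_one_zero_mul_mk_zero_one] at hs
    obtain ⟨-, -, hz⟩ := dvd_coord_of_natCast_mul_eq hs
    exact hu (by simpa using hz)
  -- so `(0, 1, 0) ∈ L`: `t₂ ∈ T` with `p t₂ = φ(ω)`
  obtain ⟨u'', rfl⟩ := hpu
  have h₂ : InL p φ T (omega f) := by
    have h := (show InL p φ T ⟨(p : ℤ) * u'', 1, 0⟩ from ⟨t₁, ht₁T, ht₁⟩).add_natCast_mul hRT ⟨-u'', 0, 0⟩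
    convert h using 1
    ext <;> simp [omega]
  obtain ⟨t₂, ht₂T, ht₂⟩ := h₂
  -- Step (c): `t₂² ∈ T` gives `p ∣ a`, `p ∣ b` and `(−ac/p, b/p, −a/p) ∈ L`
  obtain ⟨s₃, hs₃, hL₃⟩ := exists_of_mul_mem hφ hpT ht₂ ht₂ (T.mul_mem ht₂T ht₂T)
  rw [omega_mul_omega_eq] at hs₃
  obtain ⟨-, hpb, hpa⟩ := dvd_coord_of_natCast_mul_eq hs₃
  simp only at hpb hpa
  rw [dvd_neg] at hpa
  -- Dichotomy: does `L` contain an element whose `θ`-coordinate is prime to `p`?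
  rcases em (∃ r, InL p φ T r ∧ ¬ (p : ℤ) ∣ r.z) with ⟨r, hrL, hrz⟩ | hnone
  · -- some `r ∈ L` with `p ∤ r.z`: then `(β, 0, 1) ∈ L`, then `θ/p ∈ T`, then `p ∣ c, d`
    right
    -- remove the `ω`-component using `(0,1,0) ∈ L`, then scale the `z`-coordinate to `1`
    obtain ⟨e, k, hek⟩ := exists_mul_add_mul_prime_eq_one hp hrz
    have hω : InL p φ T (omega f) := ⟨t₂, ht₂T, ht₂⟩
    have hβ : InL p φ T ⟨e * r.x, 0, 1⟩ := by
      have h := (((hrL.add (hω.intCast_mul (-r.y))).intCast_mul e).add_natCast_mul hRT ⟨0, 0, k⟩)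
      convert h using 1
      ext <;> simp [omega]
      linear_combination -hek
    obtain ⟨tθ, htθT, htθ⟩ := hβ
    -- the product `t₂ tθ` forces `p ∣ β`
    obtain ⟨s₄, hs₄, -⟩ := exists_of_mul_mem hφ hpT ht₂ htθ (T.mul_mem ht₂T htθT)
    rw [omega_mul_mk_zero_one] at hs₄
    obtain ⟨-, hβp, -⟩ := dvd_coord_of_natCast_mul_eq hs₄
    simp only at hβp
    obtain ⟨β', hβ'⟩ := hβp
    -- so `(0, 0, 1) ∈ L`: `t₃ ∈ T` with `p t₃ = φ(θ)`
    have h₃ : InL p φ T (theta f) := by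
      have h := (show InL p φ T ⟨e * r.x, 0, 1⟩ from ⟨tθ, htθT, htθ⟩).add_natCast_mul hRT ⟨-β', 0, 0⟩
      convert h using 1
      ext <;> simp [theta, hβ']
    obtain ⟨t₃, ht₃T, ht₃⟩ := h₃
    -- `t₃² ∈ T` gives `p ∣ c`, `p ∣ d`
    obtain ⟨s₅, hs₅, -⟩ := exists_of_mul_mem hφ hpT ht₃ ht₃ (T.mul_mem ht₃T ht₃T)
    rw [theta_mul_theta_eq] at hs₅
    obtain ⟨-, hpd, hpc⟩ := dvd_coord_of_natCast_mul_eq hs₅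
    simp only at hpd hpc
    rw [dvd_neg] at hpc
    exact ⟨hpa, hpb, hpc, hpd⟩
  · -- `L ⊆ ℤ(0,1,0) + pR(f)`: then `p ∣ a/p`, i.e. `p² ∣ a`
    left
    refine ⟨?_, hpb⟩
    have hz : (p : ℤ) ∣ s₃.z := by
      by_contra h
      exact hnone ⟨s₃, hL₃, h⟩
    have h3 : (p : ℤ) * s₃.z = -f.a := by
      have := congrArg RingOfForm.z hs₃
      simpa using this
    obtain ⟨w, hw⟩ := hz
    exact ⟨-w, by linear_combination h3 - (p : ℤ) * hw⟩

end Key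

/-- `R(g)` is torsion-free (natural-number version). [folklore] -/
theorem natCast_mul_cancel {n : ℕ} (hn : n ≠ 0) {P Q : RingOfForm g} (h : (n : RingOfForm g) * P = n * Q) :
    P = Q := by
  apply intCast_mul_cancel (n := (n : ℤ)) (by exact_mod_cast hn)
  simpa only [Int.cast_natCast] using h

/-! ### Finite index of an injective `φ : R(f) → R(g)` -/

section Index

variable (φ : RingOfForm f →+* RingOfForm g)

/-- The determinant of `φ` on `R/ℤ·1`: with `φ(ω) = (∗, m₁₁, m₂₁)`, `φ(θ) = (∗, m₁₂, m₂₂)` it is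
`m₁₁ m₂₂ − m₁₂ m₂₁` (the full `3 × 3` matrix of `φ` on `(1, ω, θ)` is block triangular with a `1`). [folklore] -/
def detOnQuot : ℤ :=
  (φ (omega f)).y * (φ (theta f)).z - (φ (theta f)).y * (φ (omega f)).z

/-- **`D · R(g) ⊆ φ(R(f))`** for `D = detOnQuot φ` (adjugate formula): the cokernel of `φ` is killed
by `D`. [folklore] -/
theorem exists_eq_detOnQuot_mul (y : RingOfForm g) : ∃ r : RingOfForm f, φ r = (detOnQuot φ : RingOfForm g) * y := by
  set ry : ℤ := (φ (theta f)).z * y.y - (φ (theta f)).y * y.z with hry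
  set rz : ℤ := -((φ (omega f)).z * y.y) + (φ (omega f)).y * y.z with hrz
  refine ⟨⟨detOnQuot φ * y.x - ry * (φ (omega f)).x - rz * (φ (theta f)).x, ry, rz⟩, ?_⟩
  ext
  · rw [ringHom_apply_x, intCast_mul_x]; simp only; ring
  · rw [ringHom_apply_y, intCast_mul_y]; simp only [detOnQuot, hry, hrz]; ring
  · rw [ringHom_apply_z, intCast_mul_z]; simp only [detOnQuot, hry, hrz]; ring

variable {φ}

/-- **An injective `φ` has `detOnQuot φ ≠ 0`** (a kernel vector of the `2 × 2` block would give a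
nonzero element `vω + wθ` mapping into `ℤ·1 = φ(ℤ·1)`). [folklore] -/
theorem detOnQuot_ne_zero (hφ : Function.Injective φ) : detOnQuot φ ≠ 0 := by
  intro hD
  let B : Matrix (Fin 2) (Fin 2) ℤ := !![(φ (omega f)).y, (φ (theta f)).y; (φ (omega f)).z, (φ (theta f)).z]
  have hB : B.det = 0 := by rw [Matrix.det_fin_two_of, ← hD, detOnQuot]
  obtain ⟨v, hv0, hv⟩ := Matrix.exists_mulVec_eq_zero_iff.mpr hB
  have h0 := congrFun hv 0
  have h1 := congrFun hv 1
  simp only [B, Matrix.mulVec, dotProduct, Fin.sum_univ_two, Matrix.of_apply, Matrix.cons_val',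
    Matrix.cons_val_zero, Matrix.cons_val_one, Matrix.cons_val_fin_one, Matrix.empty_val',
    Pi.zero_apply] at h0 h1
  -- the element `r = v₀ ω + v₁ θ` maps to the integer `n = v₀ φ(ω)ₓ + v₁ φ(θ)ₓ`
  set n : ℤ := v 0 * (φ (omega f)).x + v 1 * (φ (theta f)).x with hn
  have hr : φ ⟨0, v 0, v 1⟩ = φ (n : RingOfForm f) := by
    rw [map_intCast]
    ext
    · rw [ringHom_apply_x]; simp [hn]
    · rw [ringHom_apply_y]; simp; linear_combination h0
    · rw [ringHom_apply_z]; simp; linear_combination h1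
  have h := hφ hr
  have hy : v 0 = 0 := by simpa using congrArg RingOfForm.y h
  have hz : v 1 = 0 := by simpa using congrArg RingOfForm.z h
  apply hv0
  ext i
  fin_cases i
  · exact hy
  · exact hz

/-- So a positive integer kills the cokernel: `N · R(g) ⊆ φ(R(f))` with `N = |D| > 0`. [folklore] -/
theorem exists_pos_forall_exists_eq_mul (hφ : Function.Injective φ) :
    ∃ N : ℕ, 0 < N ∧ ∀ y : RingOfForm g, ∃ r : RingOfForm f, φ r = (N : RingOfForm g) * y := by
  refine ⟨(detOnQuot φ).natAbs, Int.natAbs_pos.mpr (detOnQuot_ne_zero hφ), fun y => ?_⟩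
  obtain ⟨r, hr⟩ := exists_eq_detOnQuot_mul φ y
  rcases Int.natAbs_eq (detOnQuot φ) with h | h
  · exact ⟨r, by rw [hr, ← Int.cast_natCast, ← h]⟩
  · refine ⟨-r, ?_⟩
    have h' : ((detOnQuot φ).natAbs : ℤ) = -detOnQuot φ := by linarith
    rw [map_neg, hr, ← Int.cast_natCast, h', Int.cast_neg, neg_mul]

end Index

/-! ### An intermediate ring `φ(R f) ⊊ T ⊆ R(g)` with `pT ⊆ φ(R f)` -/

section Overring

variable {φ : RingOfForm f →+* RingOfForm g}

/-- The `p`-saturation `S_p = {x ∈ R(g) : pʲ x ∈ φ(R(f)) for some j}` of the image, a subring. [folklore] -/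
def satur (p : ℕ) (φ : RingOfForm f →+* RingOfForm g) : Subring (RingOfForm g) where
  carrier := {x | ∃ j : ℕ, ∃ r : RingOfForm f, φ r = (p : RingOfForm g) ^ j * x}
  mul_mem' := by
    rintro x y ⟨j, r, hr⟩ ⟨j', r', hr'⟩
    refine ⟨j + j', r * r', ?_⟩
    rw [map_mul, hr, hr', pow_add]; ring
  one_mem' := ⟨0, 1, by simp⟩
  add_mem' := by
    rintro x y ⟨j, r, hr⟩ ⟨j', r', hr'⟩
    refine ⟨j + j', (p : RingOfForm f) ^ j' * r + (p : RingOfForm f) ^ j * r', ?_⟩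
    rw [map_add, map_mul, map_mul, map_pow, map_pow, map_natCast, hr, hr', pow_add]; ring
  zero_mem' := ⟨0, 0, by simp⟩
  neg_mem' := by
    rintro x ⟨j, r, hr⟩
    exact ⟨j, -r, by rw [map_neg, hr]; ring⟩

/-- Membership in the saturation. [folklore] -/
theorem mem_satur {p : ℕ} {x : RingOfForm g} :
    x ∈ satur p φ ↔ ∃ j : ℕ, ∃ r : RingOfForm f, φ r = (p : RingOfForm g) ^ j * x := Iff.rfl

/-- The image lies in its saturation. [folklore] -/
theorem apply_mem_satur (p : ℕ) (r : RingOfForm f) : φ r ∈ satur p φ := ⟨0, r, by simp⟩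

/-- **Uniform exponent**: if `N · R(g) ⊆ φ(R f)` then a single power `p^K` (with `p^K ∥ N`) maps the
whole saturation into `φ(R f)`. [folklore] -/
theorem exists_pow_forall_satur {p : ℕ} (hp : p.Prime) {N : ℕ} (hN0 : 0 < N)
    (hN : ∀ y : RingOfForm g, ∃ r : RingOfForm f, φ r = (N : RingOfForm g) * y) :
    ∃ K : ℕ, ∀ x ∈ satur p φ, ∃ r : RingOfForm f, φ r = (p : RingOfForm g) ^ K * x := by
  obtain ⟨K, n', hn', hNeq⟩ := Nat.exists_eq_pow_mul_and_not_dvd hN0.ne' p hp.one_lt.ne'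
  refine ⟨K, fun x hx => ?_⟩
  obtain ⟨j, r₁, hr₁⟩ := hx
  obtain ⟨r₂, hr₂⟩ := hN x
  -- Bezout: `α p^j + β n' = 1`
  have hcop : Nat.Coprime (p ^ j) n' := Nat.Coprime.pow_left j ((Nat.Prime.coprime_iff_not_dvd hp).mpr hn')
  obtain ⟨α, β, hαβ⟩ := Nat.isCoprime_iff_coprime.mpr hcop
  refine ⟨(α * (p : ℤ) ^ K : ℤ) * r₁ + (β : RingOfForm f) * r₂, ?_⟩
  have hcast : ((N : ℕ) : RingOfForm g) = (p : RingOfForm g) ^ K * (n' : RingOfForm g) := by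
    rw [hNeq]; push_cast; ring
  have h1 : (α : RingOfForm g) * (p : RingOfForm g) ^ j + (β : RingOfForm g) * (n' : RingOfForm g) = 1 := by
    have h := congrArg (fun z : ℤ => (z : RingOfForm g)) hαβ
    push_cast at h
    exact h
  rw [map_add, map_mul, map_mul, map_intCast, map_intCast, hr₁, hr₂, hcast]
  push_cast
  linear_combination ((p : RingOfForm g) ^ K * x) * h1

/-- **The intermediate ring.** If `φ : R(f) ↪ R(g)` is injective but not surjective, there are a
prime `p` and a subring `T ⊆ R(g)` with `φ(R(f)) ⊆ T`, `pT ⊆ φ(R(f))` and `T ⊄ φ(R(f))`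
(namely `T = φ(R f) + p^{k−1} S_p` with `k` minimal such that `p^k S_p ⊆ φ(R f)`). [folklore] -/
theorem exists_prime_overring (hφ : Function.Injective φ) (hns : ¬ Function.Surjective φ) :
    ∃ p : ℕ, p.Prime ∧ ∃ T : Subring (RingOfForm g), (∀ r, φ r ∈ T) ∧
      (∀ t ∈ T, ∃ r, (p : RingOfForm g) * t = φ r) ∧ ∃ t ∈ T, t ∉ Set.range φ := by
  classical
  obtain ⟨N, hN0, hN⟩ := exists_pos_forall_exists_eq_mul hφ
  obtain ⟨s₀, hs₀⟩ : ∃ s₀, s₀ ∉ Set.range φ := by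
    by_contra h
    push Not at h
    exact hns fun y => h y
  -- the minimal positive `m` with `m s₀ ∈ φ(R f)`, and a prime `p ∣ m`
  have hP : ∃ m : ℕ, 0 < m ∧ ∃ r, φ r = (m : RingOfForm g) * s₀ := ⟨N, hN0, hN s₀⟩
  set m := Nat.find hP with hm
  obtain ⟨hm0, r₀, hr₀⟩ := Nat.find_spec hP
  have hm1 : m ≠ 1 := by
    intro h1
    rw [← hm, h1, Nat.cast_one, one_mul] at hr₀
    exact hs₀ ⟨r₀, hr₀⟩
  set p := m.minFac with hpdef
  have hp : p.Prime := Nat.minFac_prime hm1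
  obtain ⟨q, hq⟩ : p ∣ m := Nat.minFac_dvd m
  have hq0 : 0 < q := Nat.pos_of_ne_zero fun h => by rw [h, mul_zero] at hq; omega
  have hqm : q < m := by
    calc q = 1 * q := (one_mul q).symm
      _ < p * q := Nat.mul_lt_mul_of_pos_right hp.one_lt hq0
      _ = m := hq.symm
  -- `s = q s₀ ∉ φ(R f)` but `p s ∈ φ(R f)`
  set s : RingOfForm g := (q : RingOfForm g) * s₀ with hs
  have hsn : s ∉ Set.range φ := by
    rintro ⟨r, hr⟩
    have := Nat.find_min' hP ⟨hq0, r, hr⟩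
    rw [← hm] at this
    omega
  have hps : (p : RingOfForm g) * s = φ r₀ := by
    rw [hr₀, hs, ← mul_assoc, ← Nat.cast_mul, ← hq]
  refine ⟨p, hp, ?_⟩
  -- the saturation and the minimal exponent `k`
  obtain ⟨K, hK⟩ := exists_pow_forall_satur (φ := φ) hp hN0 hN
  have hk : ∃ k : ℕ, ∀ x ∈ satur p φ, ∃ r, φ r = (p : RingOfForm g) ^ k * x := ⟨K, hK⟩
  set k := Nat.find hk with hkdef
  have hkspec := Nat.find_spec hk
  rw [← hkdef] at hkspec
  have hsS : s ∈ satur p φ := ⟨1, r₀, by rw [pow_one, hps]⟩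
  have hk0 : k ≠ 0 := by
    intro h0
    obtain ⟨r, hr⟩ := hkspec s hsS
    rw [h0, pow_zero, one_mul] at hr
    exact hsn ⟨r, hr⟩
  obtain ⟨k', hk'⟩ : ∃ k', k = k' + 1 := ⟨k - 1, by omega⟩
  rw [hk'] at hkspec
  have hmin : ¬ ∀ x ∈ satur p φ, ∃ r, φ r = (p : RingOfForm g) ^ k' * x :=
    Nat.find_min hk (show k' < Nat.find hk by rw [← hkdef, hk']; exact Nat.lt_succ_self k')
  push Not at hmin
  obtain ⟨x₁, hx₁S, hx₁⟩ := hmin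
  -- `T = φ(R f) + p^{k'} S_p`
  let T : Subring (RingOfForm g) :=
    { carrier := {t | ∃ r, ∃ x ∈ satur p φ, t = φ r + (p : RingOfForm g) ^ k' * x}
      mul_mem' := by
        rintro t t' ⟨r, x, hx, rfl⟩ ⟨r', x', hx', rfl⟩
        refine ⟨r * r', φ r * x' + x * φ r' + (p : RingOfForm g) ^ k' * (x * x'), ?_, ?_⟩
        · exact (satur p φ).add_mem ((satur p φ).add_mem ((satur p φ).mul_mem (apply_mem_satur p r) hx')
            ((satur p φ).mul_mem hx (apply_mem_satur p r')))
            ((satur p φ).mul_mem ((satur p φ).pow_mem (natCast_mem (satur p φ) p) k') ((satur p φ).mul_mem hx hx'))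
        · rw [map_mul]; ring
      one_mem' := ⟨1, 0, (satur p φ).zero_mem, by simp⟩
      add_mem' := by
        rintro t t' ⟨r, x, hx, rfl⟩ ⟨r', x', hx', rfl⟩
        exact ⟨r + r', x + x', (satur p φ).add_mem hx hx', by rw [map_add]; ring⟩
      zero_mem' := ⟨0, 0, (satur p φ).zero_mem, by simp⟩
      neg_mem' := by
        rintro t ⟨r, x, hx, rfl⟩
        exact ⟨-r, -x, (satur p φ).neg_mem hx, by rw [map_neg]; ring⟩ }
  refine ⟨T, fun r => ⟨r, 0, (satur p φ).zero_mem, by simp⟩, ?_, ?_⟩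
  · rintro t ⟨r, x, hx, rfl⟩
    obtain ⟨r', hr'⟩ := hkspec x hx
    refine ⟨(p : RingOfForm f) * r + r', ?_⟩
    rw [map_add, map_mul, map_natCast, hr', pow_succ]; ring
  · refine ⟨(p : RingOfForm g) ^ k' * x₁, ⟨0, x₁, hx₁S, by simp⟩, ?_⟩
    rintro ⟨r, hr⟩
    exact hx₁ r hr

end Overring

/-! ### Normalization and the converse of Prop. 2.2 -/

/-- **From an overring to `f ∉ U_p`.** Let `φ : R(f) ↪ R(g)`, `p` prime, and `T` a subring of
`R(g)` with `φ(R f) ⊆ T`, `pT ⊆ φ(R f)`, `T ⊄ φ(R f)`. Then `f ∉ U_p`: writing `p t₀ = φ(x + vω + wθ)`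
with `(v, w) ≢ 0 (mod p)`, a `GL₂(ℤ)`-change of basis of `R(f)` (realized by `exists_basis_transition_eq`
and the explicit isomorphism `R(indexForm b') ≅ R(f)`) brings us to the situation of `key`. [folklore] -/
theorem not_memU_of_overring {p : ℕ} (hp : p.Prime) {φ : RingOfForm f →+* RingOfForm g}
    (hφ : Function.Injective φ) (T : Subring (RingOfForm g)) (hRT : ∀ r, φ r ∈ T)
    (hpT : ∀ t ∈ T, ∃ r, (p : RingOfForm g) * t = φ r) {t₀ : RingOfForm g} (ht₀T : t₀ ∈ T)
    (ht₀ : t₀ ∉ Set.range φ) : ¬ f.MemU p := by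
  have hp0 : (p : ℤ) ≠ 0 := by exact_mod_cast hp.ne_zero
  obtain ⟨r₁, hr₁⟩ := hpT t₀ ht₀T
  -- `(v, w) = (r₁.y, r₁.z)` is not `≡ 0 (mod p)`
  have hvw : ¬ ((p : ℤ) ∣ r₁.y ∧ (p : ℤ) ∣ r₁.z) := by
    rintro ⟨hy, hz⟩
    have hx : (p : ℤ) ∣ r₁.x := InL.dvd_x ⟨t₀, ht₀T, hr₁⟩ hy hz
    obtain ⟨x', hx'⟩ := hx
    obtain ⟨y', hy'⟩ := hy
    obtain ⟨z', hz'⟩ := hz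
    apply ht₀
    refine ⟨⟨x', y', z'⟩, natCast_mul_cancel hp.ne_zero ?_⟩
    rw [hr₁, ← map_natCast φ, ← map_mul]
    congr 1
    ext <;> simp [hx', hy', hz']
  -- `d = gcd(v, w)`, `p ∤ d`, `(v, w) = d (v₁, w₁)` with `(v₁, w₁)` primitive
  set d : ℕ := Int.gcd r₁.y r₁.z with hd
  have hd0 : 0 < d := by
    rw [hd]
    apply Int.gcd_pos_iff.mpr
    by_contra h
    push Not at h
    exact hvw ⟨by rw [h.1]; exact dvd_zero _, by rw [h.2]; exact dvd_zero _⟩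
  have hpd : ¬ (p : ℤ) ∣ (d : ℤ) := fun h =>
    hvw ⟨h.trans (hd ▸ Int.gcd_dvd_left _ _), h.trans (hd ▸ Int.gcd_dvd_right _ _)⟩
  obtain ⟨v₁, hv₁⟩ : (d : ℤ) ∣ r₁.y := hd ▸ Int.gcd_dvd_left _ _
  obtain ⟨w₁, hw₁⟩ : (d : ℤ) ∣ r₁.z := hd ▸ Int.gcd_dvd_right _ _
  have hcop : IsCoprime v₁ w₁ := by
    rw [Int.isCoprime_iff_gcd_eq_one]
    have h := Int.gcd_div_gcd_div_gcd (i := r₁.y) (j := r₁.z) (hd ▸ hd0)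
    have hd0' : (d : ℤ) ≠ 0 := by exact_mod_cast hd0.ne'
    rwa [← hd, hv₁, hw₁, Int.mul_ediv_cancel_left _ hd0', Int.mul_ediv_cancel_left _ hd0'] at h
  obtain ⟨α, β, hαβ⟩ := hcop
  -- the unimodular `γ = (v₁ w₁; −β α)` and the new basis `b'` of `R(f)`
  let γ : Matrix (Fin 2) (Fin 2) ℤ := !![v₁, w₁; -β, α]
  have hγ : γ.det = 1 := by rw [Matrix.det_fin_two_of]; linear_combination hαβ
  have hγu : IsUnit γ.det := by rw [hγ]; exact isUnit_one
  obtain ⟨b', hb'0, hb'1, -, htr⟩ := exists_basis_transition_eq (basis f) basis_zero γ hγu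
  have hequiv : GL2ZEquiv f (indexForm b') := by
    refine ⟨γ, hγu, ?_⟩
    rw [indexForm_eq_twist_transition (basis f) b' basis_zero hb'0, htr, indexForm_basis]
  -- the explicit isomorphism `e : R(indexForm b') ≅ R(f)` and `φ'' = φ ∘ e`
  obtain ⟨e, he⟩ := exists_ringEquiv_indexForm b' hb'0
  set c₂ : ℤ := b'.repr (b' 1 * b' 2) 2 with hc₂
  let φ'' : RingOfForm (indexForm b') →+* RingOfForm g := φ.comp e.toRingHom
  have hφ''apply : ∀ P, φ'' P = φ (e P) := fun P => rfl
  have hφ'' : Function.Injective φ'' := hφ.comp e.injective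
  have hRT'' : ∀ P, φ'' P ∈ T := fun P => hRT _
  have hpT'' : ∀ t ∈ T, ∃ P, (p : RingOfForm g) * t = φ'' P := by
    intro t ht
    obtain ⟨r, hr⟩ := hpT t ht
    exact ⟨e.symm r, by rw [hφ''apply, RingEquiv.apply_symm_apply, hr]⟩
  -- `r₁ = e (x + d c₂, d, 0)`
  have hb'1' : b' 1 = (v₁ : RingOfForm f) * omega f + (w₁ : RingOfForm f) * theta f := by
    rw [hb'1, basis_one, basis_two, zsmul_eq_mul, zsmul_eq_mul]
    simp [γ]
  have hr₁e : r₁ = e ⟨r₁.x + (d : ℤ) * c₂, d, 0⟩ := by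
    rw [he, hb'1']
    ext <;> simp only [add_x, add_y, add_z, mul_x, mul_y, mul_z, sub_x, sub_y, sub_z, intCast_x,
      intCast_y, intCast_z, omega_x, omega_y, omega_z, theta_x, theta_y, theta_z, hv₁, hw₁, Int.cast_natCast,
      natCast_x, natCast_y, natCast_z] <;> ring
  have hL : InL p φ'' T ⟨r₁.x + (d : ℤ) * c₂, d, 0⟩ :=
    ⟨t₀, ht₀T, by rw [hφ''apply, ← hr₁e, hr₁]⟩
  -- scale by `e' ≡ d⁻¹ (mod p)` to reach `(u, 1, 0) ∈ L`
  obtain ⟨e', k, hek⟩ := exists_mul_add_mul_prime_eq_one hp hpd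
  have hL1 : InL p φ'' T ⟨e' * (r₁.x + (d : ℤ) * c₂), 1, 0⟩ := by
    have h := (hL.intCast_mul e').add_natCast_mul hRT'' ⟨0, k, 0⟩
    convert h using 1
    ext <;> simp
    linear_combination -hek
  -- the key lemma for `indexForm b'`
  have hkey := key hp hφ'' hRT'' hpT'' _ hL1
  intro hU
  have hU' : (indexForm b').MemU p := hU.of_gl2zEquiv hequiv
  rcases hkey with ⟨ha, hb⟩ | hm
  · exact hU'.2 ⟨indexForm b', GL2ZEquiv.refl _, ha, hb⟩
  · exact hU'.1 hm

/-- **`f ∈ U_p` for all primes `p` ⇒ `R(f)` is maximal** (Davenport–Heilbronn; BTT 2023, Prop. 2.2,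
"if"). [cite: BhargavaTaniguchiThorne2023, Proposition 2.2 (f ∈ U_p for all p ⇒ R maximal)] -/
theorem isMaximal_of_memU (h : ∀ p : ℕ, p.Prime → f.MemU p) : IsMaximal f := by
  intro g φ hφ
  by_contra hns
  obtain ⟨p, hp, T, hRT, hpT, t₀, ht₀T, ht₀⟩ := exists_prime_overring hφ hns
  exact not_memU_of_overring hp hφ T hRT hpT ht₀T ht₀ (h p hp)

/-- **BTT 2023, Proposition 2.2 (Davenport–Heilbronn maximality):** the cubic ring `R(f)` is
maximal if and only if `f ∈ U_p` for every prime `p`. [cite: BhargavaTaniguchiThorne2023, Proposition 2.2 (R maximal ⇔ f ∈ U_p for all p)] -/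
theorem isMaximal_iff_memU : IsMaximal f ↔ ∀ p : ℕ, p.Prime → f.MemU p :=
  ⟨fun h _ hp => memU_of_isMaximal h hp.one_lt, isMaximal_of_memU⟩

end RingOfForm

end Literature.NumberTheory.CubicFields
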